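import Summits.AtomisticToContinuum.BoseEinsteinCondensation.Theorems.BECThomsonPrincipleGDTransferSeededSpectralIntDefs
import Summits.AtomisticToContinuum.BoseEinsteinCondensation.Theorems.BECThomsonPrincipleGDTransferSeededSpectralSeed

/-!
# Route `BECThomsonPrinciple`, crux `GDTransfer` (stmt-AtomisticToContinuum-9482), line `seeded-continuity`:
# spectral seed programme — the ASSEMBLY for the INTEGRABLE class `seedForInt_of_kyFanGapFloor`

Supports (does not close) stmt-AtomisticToContinuum-9482: proves the registered sub-goal
`seedForInt_of_kyFanGapFloor : SmoothBlockAlgebra → SmoothSplittingInt → PinchingBoundInt → CatKyFan →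
∀ v, IsRepulsiveFiniteRange v → IsIntegrableProfile v → KyFanGapFloorFor v → NoBalancedCatFor v`
of the lead's eighth Defs file `…SeededSpectralIntDefs` (wave 3 of the spectral seed programme: the twin of
the finite continuous assembly `seedFor_of_kyFanGapFloor` of `…SeededSpectralSeed` for skeleton v8's soft class —
profiles finite on `[0, ∞)` with integrable lift).

**Proof.**  Verbatim the finite continuous assembly, with the integrable splitting / pinching twins as
hypotheses: fix band parameters `θ, β` (`w = 1 − β − θ > 0`), put `τ = 1/4` (so `8/τ² = 128`),
`‖v‖₁ = lift1 v` (finite: the lift is integrable), and take the gap constant `K = 256 + 81920 π² ‖v‖₁ / w²`;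
the Ky Fan gap floor at `K` gives `ρ₀, N₀`.  At `(N, L) = (m + 1, L)` on the dilute path with `E₀ ≠ ⊤` choose
the slack `δ = w² / (2 (w² + 128π²) L³)`.  If a `δ`-near-minimiser `Ψ` carried mass `≥ τ` on both sides, its
two smooth blocks `f = χ_lo(n̂₀/N)Ψ`, `g = χ_hi(n̂₀/N)Ψ` satisfy
`𝓔(f) + 𝓔(g) ≤ E(Ψ) + (8π²/(w²N²))·D(Ψ) ≤ E₀ + Δ`, `Δ = δ + (8π²/(w²N²))·D(Ψ)` (`SmoothSplittingInt`),
where the pinched interaction is `D(Ψ) ≤ 16 ∫V|Ψ|² + 64‖v‖₁N²/L³` (`PinchingBoundInt`),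
`∫V|Ψ|² ≤ E(Ψ) ≤ E₀ + δ` and `E₀ ≤ N²‖v‖₁/L³` (constant trial state,
`PlainCost.periodicGroundStateEnergy_le_const`); so `D(Ψ)`, `Δ` and hence BOTH block forms are finite
(each summand of the finite `𝓔(f) + 𝓔(g) ≤ E₀ + Δ < ∞` — no bound of the interaction on configuration space
is needed, an integrable core may be unbounded), and `128·Δ ≤ 64/L³ + 81920π²‖v‖₁/(w²L³) < K/L³`
(`SpectralSeed.cost_lt_gap`, reused).  But `CatKyFan` gives `kyFanTwo ≤ 2E₀ + 128Δ` while the floor gives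
`2E₀ + K/L³ ≤ kyFanTwo`, and `2E₀ < ∞` — contradiction.

References: ReedSimonIV1978 Thm XIII.1–2 (min-max, Ky Fan); CyconFroeseKirschSimon1987 §3.1 (IMS
localisation); LSSY2005 §1.2; Fournais2020 Assumption 1.1 (the integrable class).
-/

noncomputable section

open MeasureTheory Filter
open scoped ENNReal NNReal ComplexConjugate

namespace Summit.AtomisticToContinuum.BoseEinsteinCondensation.Cruxes.GDTransfer.Seeded

open Literature.MathematicalPhysics.QuantumManyBody.BoseGas
open Summit.AtomisticToContinuum.BoseEinsteinCondensation.Cruxes.GDTransfer.DysonDressedWitness (eform)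

/-- **Registered sub-goal `seedForInt_of_kyFanGapFloor` of the spectral seed programme** (line
`seeded-continuity`, crux `GDTransfer`, stmt-AtomisticToContinuum-9482), integrable class: at an admissible
profile finite on `[0, ∞)` with integrable lift, a Ky Fan gap floor `kyFanTwo − 2E₀ ≥ K/L³` along the dilute
path excludes balanced cats among near-minimisers with `τ = 1/4` chosen BEFORE `N` — the smooth IMS split
(`SmoothSplittingInt`, cost `8π²/(w²N²)·D`), the pinching bound (`PinchingBoundInt`,
`D ≤ 16∫V|Ψ|² + 64‖v‖₁N²/L³`), the constant-state bound `E₀ ≤ N²‖v‖₁/L³` and the Gram–Schmidt Ky Fan bound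
(`CatKyFan`) assembled with the explicit constants of `SpectralSeed.cost_lt_gap`; the block forms are finite
as summands of `𝓔(f) + 𝓔(g) ≤ E₀ + Δ < ∞`. [cite: ReedSimonIV1978, Thm XIII.1] -/
theorem seedForInt_of_kyFanGapFloor : SmoothBlockAlgebra → SmoothSplittingInt → PinchingBoundInt → CatKyFan →
    ∀ v : ℝ → ℝ≥0∞, IsRepulsiveFiniteRange v → IsIntegrableProfile v → KyFanGapFloorFor v →
      NoBalancedCatFor v := by
  intro hB hS hP hK v hv hi hGap θ β hθ hβ hθβ
  have hw : 0 < 1 - β - θ := by linarith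
  have hmeas : Measurable v := hv.1
  -- `‖v‖₁ = lift1 v` is a finite nonnegative real
  have hint : (∫⁻ x : Space, v ‖x‖) ≠ ⊤ := hi.2
  have hI0 : 0 ≤ lift1 v := ENNReal.toReal_nonneg
  have hIeq : (∫⁻ x : Space, v ‖x‖) = ENNReal.ofReal (lift1 v) := (ENNReal.ofReal_toReal hint).symm
  -- the gap constant and the dilute path from the floor
  set K : ℝ := 256 + 81920 * Real.pi ^ 2 * lift1 v / (1 - β - θ) ^ 2
  have hK0 : 0 < K := by positivity
  obtain ⟨ρ₀, hρ₀, N₀, hN₀⟩ := hGap K hK0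
  refine ⟨1 / 4, by norm_num, by norm_num, ρ₀, hρ₀, N₀, fun m hm L hL hρ hE₀ => ?_⟩
  -- the slack
  set δr : ℝ := (1 - β - θ) ^ 2 / (2 * ((1 - β - θ) ^ 2 + 128 * Real.pi ^ 2) * L ^ 3)
  have hδr0 : 0 < δr := by positivity
  refine ⟨ENNReal.ofReal δr, ENNReal.ofReal_pos.2 hδr0, fun Ψ hΨ hcat => ?_⟩
  obtain ⟨hlo, hhi⟩ := hcat
  set E₀ := periodicGroundStateEnergy v (m + 1) L
  -- the smooth splitting: `𝓔(f) + 𝓔(g) ≤ E(Ψ) + A·D ≤ E₀ + Δ`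
  set A := ENNReal.ofReal (8 * Real.pi ^ 2 / ((1 - β - θ) ^ 2 * (((m : ℝ) + 1) ^ 2))) with hA_def
  set D := sectorDiagV v m L Ψ.ψ
  have hsplit : eform v L (smoothBlock m L (cutLo θ β) Ψ.ψ) +
      eform v L (smoothBlock m L (cutHi θ β) Ψ.ψ) ≤ periodicEnergy v Ψ + A * D :=
    hS v hv hi m L hL θ β hθ hβ hθβ Ψ
  set Δ := ENNReal.ofReal δr + A * D with hΔ_def
  have hsum : eform v L (smoothBlock m L (cutLo θ β) Ψ.ψ) +
      eform v L (smoothBlock m L (cutHi θ β) Ψ.ψ) ≤ E₀ + Δ := by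
    refine hsplit.trans ?_
    rw [hΔ_def, ← add_assoc]
    exact add_le_add hΨ le_rfl
  -- the cost in real terms
  have hWΨ : (∫⁻ X in cellN (m + 1) L, periodicInteraction v L X * (‖Ψ.ψ X‖₊ : ℝ≥0∞) ^ 2) ≤
      E₀ + ENNReal.ofReal δr :=
    (PlainCost.lintegral_W_le_eform v L Ψ.ψ).trans hΨ
  have hE₀le : E₀ ≤ ENNReal.ofReal (((m : ℝ) + 1) ^ 2 / L ^ 3 * lift1 v) := by
    calc E₀ ≤ ENNReal.ofReal (((m : ℝ) + 1) ^ 2 / L ^ 3) * ∫⁻ x : Space, v ‖x‖ :=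
          PlainCost.periodicGroundStateEnergy_le_const hmeas m hL
      _ = ENNReal.ofReal (((m : ℝ) + 1) ^ 2 / L ^ 3 * lift1 v) := by
          rw [hIeq, ← ENNReal.ofReal_mul (by positivity)]
  have hDle : D ≤ ENNReal.ofReal (16 * (((m : ℝ) + 1) ^ 2 / L ^ 3 * lift1 v + δr) +
      64 * lift1 v * ((m : ℝ) + 1) ^ 2 / L ^ 3) := by
    calc D ≤ 16 * (∫⁻ X in cellN (m + 1) L, periodicInteraction v L X * (‖Ψ.ψ X‖₊ : ℝ≥0∞) ^ 2) +
          ENNReal.ofReal (64 * lift1 v * ((m : ℝ) + 1) ^ 2 / L ^ 3) := hP v hv hi m L hL Ψ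
      _ ≤ 16 * (ENNReal.ofReal (((m : ℝ) + 1) ^ 2 / L ^ 3 * lift1 v) + ENNReal.ofReal δr) +
          ENNReal.ofReal (64 * lift1 v * ((m : ℝ) + 1) ^ 2 / L ^ 3) := by
          gcongr
          exact hWΨ.trans (add_le_add hE₀le le_rfl)
      _ = ENNReal.ofReal (16 * (((m : ℝ) + 1) ^ 2 / L ^ 3 * lift1 v + δr) +
          64 * lift1 v * ((m : ℝ) + 1) ^ 2 / L ^ 3) := by
          rw [← ENNReal.ofReal_add (by positivity) hδr0.le, ← ENNReal.ofReal_ofNat 16,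
            ← ENNReal.ofReal_mul (by norm_num), ← ENNReal.ofReal_add (by positivity) (by positivity)]
  -- the block forms are finite: summands of `𝓔(f) + 𝓔(g) ≤ E₀ + Δ < ∞`
  have hAtop : A ≠ ⊤ := by rw [hA_def]; exact ENNReal.ofReal_ne_top
  have hΔtop : Δ ≠ ⊤ := by
    rw [hΔ_def]
    exact ENNReal.add_ne_top.2
      ⟨ENNReal.ofReal_ne_top, ENNReal.mul_ne_top hAtop (ne_top_of_le_ne_top ENNReal.ofReal_ne_top hDle)⟩
  have hfg : eform v L (smoothBlock m L (cutLo θ β) Ψ.ψ) +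
      eform v L (smoothBlock m L (cutHi θ β) Ψ.ψ) ≠ ⊤ :=
    ne_top_of_le_ne_top (ENNReal.add_ne_top.2 ⟨hE₀, hΔtop⟩) hsum
  have hftop : eform v L (smoothBlock m L (cutLo θ β) Ψ.ψ) ≠ ⊤ := (ENNReal.add_ne_top.1 hfg).1
  have hgtop : eform v L (smoothBlock m L (cutHi θ β) Ψ.ψ) ≠ ⊤ := (ENNReal.add_ne_top.1 hfg).2
  -- the cat forces a small Ky Fan gap …
  have hup : kyFanTwo v (m + 1) L ≤ 2 * E₀ + ENNReal.ofReal (8 / (1 / 4) ^ 2) * Δ :=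
    hK hB v hmeas m L hL hE₀ θ β hθ hβ hθβ (1 / 4) (by norm_num) (by norm_num) Ψ Δ hftop hgtop hsum
      hlo hhi
  -- … while the floor is `K/L³`
  have hdown : 2 * E₀ + ENNReal.ofReal (K / L ^ 3) ≤ kyFanTwo v (m + 1) L := hN₀ m hm L hL hρ
  have hΔle : ENNReal.ofReal (8 / (1 / 4) ^ 2) * Δ ≤
      ENNReal.ofReal (128 * (δr + 8 * Real.pi ^ 2 / ((1 - β - θ) ^ 2 * (((m : ℝ) + 1) ^ 2)) *
        (16 * (((m : ℝ) + 1) ^ 2 / L ^ 3 * lift1 v + δr) +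
          64 * lift1 v * ((m : ℝ) + 1) ^ 2 / L ^ 3))) := by
    have h128 : (8 / (1 / 4) ^ 2 : ℝ) = 128 := by norm_num
    calc ENNReal.ofReal (8 / (1 / 4) ^ 2) * Δ
        ≤ ENNReal.ofReal (8 / (1 / 4) ^ 2) * (ENNReal.ofReal δr + A *
            ENNReal.ofReal (16 * (((m : ℝ) + 1) ^ 2 / L ^ 3 * lift1 v + δr) +
              64 * lift1 v * ((m : ℝ) + 1) ^ 2 / L ^ 3)) := by
          rw [hΔ_def]; gcongr
      _ = _ := by
          rw [hA_def, ← ENNReal.ofReal_mul (by positivity), ← ENNReal.ofReal_add hδr0.le (by positivity),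
            ← ENNReal.ofReal_mul (by positivity), h128]
  -- the arithmetic: `128·(δ + cost) < K/L³`
  have hN1 : (1 : ℝ) ≤ (m : ℝ) + 1 := le_add_of_nonneg_left m.cast_nonneg
  have hreal := SpectralSeed.cost_lt_gap (lift1 v) hw hL hN1
  have hlt : 2 * E₀ + ENNReal.ofReal (8 / (1 / 4) ^ 2) * Δ < 2 * E₀ + ENNReal.ofReal (K / L ^ 3) :=
    ENNReal.add_lt_add_left (ENNReal.mul_ne_top ENNReal.ofNat_ne_top hE₀)
      (hΔle.trans_lt ((ENNReal.ofReal_lt_ofReal_iff (by positivity)).2 hreal))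
  exact lt_irrefl _ ((hdown.trans hup).trans_lt hlt)

end Summit.AtomisticToContinuum.BoseEinsteinCondensation.Cruxes.GDTransfer.Seeded

end
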